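import Mathlib
import Literature.Probability.Percolation.PercolationProofs
import Literature.Probability.Percolation.ConditionalPositiveAssociation
import Literature.Probability.Percolation.ConditionalPositiveAssociationProofs
import Literature.Probability.Percolation.TwoClusterConditionalAssociation
import Literature.Probability.Percolation.TwoClusterConditionalAssociationProofs
import Summits.CriticalPhenomena.PercolationContinuityZ3.Theorems.PercNearOneGluingAdditiveGluingOffObserverFibres
import Summits.CriticalPhenomena.PercolationContinuityZ3.Theorems.PercNearOneGluingAdditiveGluingBlockPockets
import Summits.CriticalPhenomena.PercolationContinuityZ3.Theorems.PercNearOneGluingAdditiveGluingVariants1359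
import HarnessLib

/-! # Crux `PercNearOneGluing.AdditiveGluing` (stmt-CriticalPhenomena-4576), line `peel`, stub `stub_ratioMonotonePair` —
# the pair step at ONE relay, part 1: the odds inequality

Support file (`--supports stmt-CriticalPhenomena-4576`); no definitions, no named facts.  Theorems-side copy of the first half of
the crux workfile `Cruxes/AdditiveGluing/RatioOneRelay.lean` (control-strategist seat g2, sorry-free), which is not importable from
`Theorems/`; names `ratioOneRelay_*` ↦ `pairStep_*` (the workfile's names stay reserved to it).

`μ = prodBernoulli w`; vertices `a` (the designated relay), `s` (the observer), `v` (a bystander), `b` (the target);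
`D = {a ↮ s}`; on `D`, "`a` wins" = `{a ↔ b}` and "`s` wins" = `{s ↔ b}`.
* `pairStep_winner_attracts` (**the winner's cluster attracts the bystander**): `μ(D ∩ a↔b) · μ(D ∩ s↔b ∩ a↔v) ≤
  μ(D ∩ s↔b) · μ(D ∩ a↔b ∩ a↔v)` — BHK 2006 Thm 1.3 for the cluster of `a` given `{a ↮ s}` and Thm 1.4 (negative correlation
  of `C_s` and `C_a` given `{s ↮ a}`), i.e. Kozma–Nitzan's Lemma 1 twice.
* `pairStep_odds` (**one-relay ratio monotonicity**): for the block `S = {s, v}`,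
  `μ(S↔b, a↮S) · μ(a↔b, s↮b) ≥ μ(s↔b, a↮s) · μ(a↔b, S↮b)` — gluing a bystander onto the observer does not lower the odds of
  beating the designated relay.  With one relay (`A = {b, a}`) this is exactly the stub `K(S)·Z(s) ≥ K(s)·Z(S)` (part 2,
  `…PairStepOneRelay.lean`).
[cite: VandenbergHaggstromKahn2005, Thm. 1.3 (p. 6), Thm. 1.4 (p. 7); KozmaNitzan2024, Lemma 1 (pp. 5–6), §3.2 pp. 12–14]
-/

namespace Summit.CriticalPhenomena.PercolationContinuityZ3.Theorems

open MeasureTheory Set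
open Literature.Probability.LatticeModels (prodBernoulli)
open Literature.Probability.Percolation

noncomputable section
open Classical

section PairStepOdds

variable {n : ℕ}

/-- The vertex-hitting indicator `C ↦ 1{t = x ∨ t ∈ V(C)}` is monotone in the edge set. [folklore] -/
theorem pairStep_hit_mono (x t : Fin n) :
    Monotone fun C : Set (Sym2 (Fin n)) => (if (t = x ∨ ∃ e ∈ C, t ∈ e) then (1 : ℝ) else 0) := by
  intro C C' h
  by_cases hC : (t = x ∨ ∃ e ∈ C, t ∈ e)
  · have hC' : (t = x ∨ ∃ e ∈ C', t ∈ e) := by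
      rcases hC with ht | ⟨e, he, hte⟩
      · exact Or.inl ht
      · exact Or.inr ⟨e, h he, hte⟩
    simp only [hC, hC', if_true, le_refl]
  · simp only [hC, if_false]
    split_ifs <;> norm_num

/-- On the open edge cluster of `x`, the hitting indicator of `t` is the indicator of `{x ↔ t}`. [folklore] -/
theorem pairStep_hit_apply (x t : Fin n) (ω : BondConfig (Fin n)) :
    (if (t = x ∨ ∃ e ∈ openEdgeCluster ω x, t ∈ e) then (1 : ℝ) else 0) =
      (openConn x t : Set (BondConfig (Fin n))).indicator 1 ω := by
  by_cases h : (openGraph ω).Reachable x t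
  · rw [if_pos ((reachable_iff_exists_mem_openEdgeCluster ω x t).1 h),
      Set.indicator_of_mem (show ω ∈ openConn x t from h), Pi.one_apply]
  · rw [if_neg (fun h' => h ((reachable_iff_exists_mem_openEdgeCluster ω x t).2 h')),
      Set.indicator_of_notMem (show ω ∉ openConn x t from h)]

/-- Set integral of an indicator: `∫_D 1_E dμ = μ(D ∩ E)` (everything is measurable on the finite configuration space).
[folklore] -/
theorem pairStep_setIntegral_indicator (w : Sym2 (Fin n) → unitInterval) (D E : Set (BondConfig (Fin n))) :
    ∫ ω in D, E.indicator (1 : BondConfig (Fin n) → ℝ) ω ∂(prodBernoulli w) = (prodBernoulli w).real (D ∩ E) := by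
  rw [integral_indicator_one (MeasurableSet.of_discrete), measureReal_restrict_apply (MeasurableSet.of_discrete),
    Set.inter_comm]

/-- Set integral of a product of two indicators. [folklore] -/
theorem pairStep_setIntegral_indicator_mul (w : Sym2 (Fin n) → unitInterval)
    (D E E' : Set (BondConfig (Fin n))) :
    ∫ ω in D, E.indicator (1 : BondConfig (Fin n) → ℝ) ω * E'.indicator (1 : BondConfig (Fin n) → ℝ) ω
        ∂(prodBernoulli w) = (prodBernoulli w).real (D ∩ E ∩ E') := by
  have h : ∀ ω : BondConfig (Fin n), E.indicator (1 : BondConfig (Fin n) → ℝ) ω * E'.indicator 1 ω =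
      (E ∩ E').indicator (1 : BondConfig (Fin n) → ℝ) ω := by
    intro ω
    rw [← Set.indicator_indicator]
    by_cases hE : ω ∈ E
    · rw [Set.indicator_of_mem hE, Set.indicator_of_mem hE, Pi.one_apply, one_mul]
    · rw [Set.indicator_of_notMem hE, Set.indicator_of_notMem hE, zero_mul]
  simp_rw [h]
  rw [pairStep_setIntegral_indicator, Set.inter_assoc]

/-- **The winner's cluster attracts the bystander** (KN Lemma 1 twice): with `D = {a ↮ s}`,
`μ(D ∩ a↔b) · μ(D ∩ s↔b ∩ a↔v) ≤ μ(D ∩ s↔b) · μ(D ∩ a↔b ∩ a↔v)`.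
[cite: VandenbergHaggstromKahn2005, Thm. 1.3 (p. 6), Thm. 1.4 (p. 7); KozmaNitzan2024, Lemma 1 (pp. 5–6)] -/
theorem pairStep_winner_attracts (w : Sym2 (Fin n) → unitInterval) (a s v b : Fin n) (has : a ≠ s) :
    (prodBernoulli w).real ((openConn a s)ᶜ ∩ openConn a b)
        * (prodBernoulli w).real ((openConn a s)ᶜ ∩ openConn s b ∩ openConn a v) ≤
      (prodBernoulli w).real ((openConn a s)ᶜ ∩ openConn s b)
        * (prodBernoulli w).real ((openConn a s)ᶜ ∩ openConn a b ∩ openConn a v) := by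
  -- the two conditioning sets of BHK are both `{a ↮ s}`
  have hD1 : {ω : BondConfig (Fin n) | ∀ x ∈ ({s} : Set (Fin n)), ¬ (openGraph ω).Reachable a x} =
      (openConn a s : Set (BondConfig (Fin n)))ᶜ := by
    ext ω
    simp only [Set.mem_setOf_eq, Set.mem_singleton_iff, forall_eq, Set.mem_compl_iff]
    rfl
  have hD2 : {ω : BondConfig (Fin n) | ¬ (openGraph ω).Reachable s a} =
      (openConn a s : Set (BondConfig (Fin n)))ᶜ := by
    ext ω
    simp only [Set.mem_setOf_eq, Set.mem_compl_iff]
    rw [show (ω ∈ openConn a s ↔ (openGraph ω).Reachable a s) from Iff.rfl]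
    exact ⟨fun h h' => h h'.symm, fun h h' => h h'.symm⟩
  set D : Set (BondConfig (Fin n)) := (openConn a s)ᶜ with hD
  -- Step A: BHK Thm 1.3 for the cluster of `a` given `{a ↮ s}`, functions `1{b ∈ C_a}`, `1{v ∈ C_a}`
  have hA := BHK2006_clusterConditionalPositiveAssociation_holds (Fin n) w a ({s} : Set (Fin n))
    (fun C => if (b = a ∨ ∃ e ∈ C, b ∈ e) then (1 : ℝ) else 0)
    (fun C => if (v = a ∨ ∃ e ∈ C, v ∈ e) then (1 : ℝ) else 0)
    (pairStep_hit_mono a b) (pairStep_hit_mono a v) (by simpa using has)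
  rw [hD1] at hA
  simp only [pairStep_hit_apply] at hA
  rw [pairStep_setIntegral_indicator, pairStep_setIntegral_indicator,
    pairStep_setIntegral_indicator_mul] at hA
  -- Step B: BHK Thm 1.4 for the clusters of `s` and `a` given `{s ↮ a}`, functions `1{b ∈ C_s}`, `1{v ∈ C_a}`
  have hB := BHK2006_twoClusterConditionalAssociation_holds.negCorrelation (Fin n) w s a
    (fun C => if (b = s ∨ ∃ e ∈ C, b ∈ e) then (1 : ℝ) else 0)
    (fun C => if (v = a ∨ ∃ e ∈ C, v ∈ e) then (1 : ℝ) else 0)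
    (pairStep_hit_mono s b) (pairStep_hit_mono a v) (Ne.symm has)
  rw [hD2] at hB
  simp only [pairStep_hit_apply] at hB
  rw [pairStep_setIntegral_indicator, pairStep_setIntegral_indicator,
    pairStep_setIntegral_indicator_mul] at hB
  -- algebra: d·A_bv ≥ A_b·A_v and d·S_bv ≤ S_b·A_v give d·(A_b S_bv) ≤ d·(S_b A_bv); then cancel d (or everything is 0)
  set d := (prodBernoulli w).real D with hd
  set Ab := (prodBernoulli w).real (D ∩ openConn a b) with hAb
  set Av := (prodBernoulli w).real (D ∩ openConn a v) with hAv
  set Abv := (prodBernoulli w).real (D ∩ openConn a b ∩ openConn a v) with hAbv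
  set Sb := (prodBernoulli w).real (D ∩ openConn s b) with hSb
  set Sbv := (prodBernoulli w).real (D ∩ openConn s b ∩ openConn a v) with hSbv
  have hAb0 : 0 ≤ Ab := measureReal_nonneg
  have hSb0 : 0 ≤ Sb := measureReal_nonneg
  have hAbv0 : 0 ≤ Abv := measureReal_nonneg
  have hSbv0 : 0 ≤ Sbv := measureReal_nonneg
  have hAb_le : Ab ≤ d := measureReal_mono Set.inter_subset_left (measure_ne_top _ _)
  have hSbv_le : Sbv ≤ d :=
    measureReal_mono (Set.inter_subset_left.trans Set.inter_subset_left) (measure_ne_top _ _)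
  have h1 : d * (Ab * Sbv) ≤ Ab * (Sb * Av) := by
    have := mul_le_mul_of_nonneg_left hB hAb0
    linarith
  have h2 : Ab * (Sb * Av) ≤ d * (Sb * Abv) := by
    have := mul_le_mul_of_nonneg_left hA hSb0
    linarith
  by_cases hd0 : d = 0
  · have hAb' : Ab = 0 := le_antisymm (hd0 ▸ hAb_le) hAb0
    rw [hAb', zero_mul]
    exact mul_nonneg hSb0 hAbv0
  · have hdpos : 0 < d := lt_of_le_of_ne measureReal_nonneg (Ne.symm hd0)
    exact le_of_mul_le_mul_left (h1.trans h2) hdpos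

/-- `{x ↔ b} ∩ {y ↮ b} = {x ↮ y} ∩ {x ↔ b}`: the winner/loser event in conditional form. [folklore] -/
theorem pairStep_win_eq (x y b : Fin n) :
    (openConn x b : Set (BondConfig (Fin n))) ∩ (openConn y b)ᶜ = (openConn x y)ᶜ ∩ openConn x b := by
  ext ω
  simp only [Set.mem_inter_iff, Set.mem_compl_iff]
  constructor
  · rintro ⟨hxb, hyb⟩
    exact ⟨fun hxy => hyb ((SimpleGraph.Reachable.symm hxy).trans hxb), hxb⟩
  · rintro ⟨hxy, hxb⟩
    exact ⟨hxb, fun hyb => hxy (hxb.trans (SimpleGraph.Reachable.symm hyb))⟩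

/-- **One-relay ratio monotonicity** (the line's stub with `A = {b, a}`, and the penalty-free part of it in general):
for the block `S = {s, v}`,  `μ(s↔b, a↮s) · μ(a↔b, s↮b, v↮b) ≤ μ((s↔b ∨ v↔b), a↮s, a↮v) · μ(a↔b, s↮b)` —
the odds of beating the designated relay do not decrease when a bystander is glued onto the observer.  Proof: the
identity `WIN_S·LOSE_s − WIN_s·LOSE_S = [S1 margin] + μ(fresh win)·LOSE_s` and `pairStep_winner_attracts`.
[cite: KozmaNitzan2024, §3.2 pp. 12–14, Lemma 1 (pp. 5–6); VandenbergHaggstromKahn2005, Thms. 1.3–1.4 (pp. 6–7)] -/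
theorem pairStep_odds (w : Sym2 (Fin n) → unitInterval) (a s v b : Fin n) (has : a ≠ s) :
    (prodBernoulli w).real (openConn s b ∩ (openConn a s)ᶜ)
        * (prodBernoulli w).real (openConn a b ∩ (openConn s b)ᶜ ∩ (openConn v b)ᶜ) ≤
      (prodBernoulli w).real ((openConn s b ∪ openConn v b) ∩ (openConn a s)ᶜ ∩ (openConn a v)ᶜ)
        * (prodBernoulli w).real (openConn a b ∩ (openConn s b)ᶜ) := by
  have hW := pairStep_winner_attracts w a s v b has
  -- names
  set D : Set (BondConfig (Fin n)) := (openConn a s)ᶜ with hD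
  have hE1 : (openConn s b : Set (BondConfig (Fin n))) ∩ (openConn a s)ᶜ = D ∩ openConn s b := Set.inter_comm _ _
  have hE2 : (openConn a b : Set (BondConfig (Fin n))) ∩ (openConn s b)ᶜ = D ∩ openConn a b :=
    pairStep_win_eq a s b
  -- split `a wins` by the bystander reaching `b` (⟺ reaching `a` on `{a ↔ b}`)
  have hsplit : (prodBernoulli w).real (openConn a b ∩ (openConn s b)ᶜ ∩ (openConn v b)ᶜ) =
      (prodBernoulli w).real (D ∩ openConn a b) - (prodBernoulli w).real (D ∩ openConn a b ∩ openConn a v) := by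
    rw [hE2]
    have h := measureReal_inter_add_sdiff (μ := prodBernoulli w) (s := D ∩ openConn a b)
      (MeasurableSet.of_discrete (s := (openConn a v : Set (BondConfig (Fin n)))))
    have hdiff : (D ∩ openConn a b) \ (openConn a v : Set (BondConfig (Fin n))) =
        D ∩ openConn a b ∩ (openConn v b)ᶜ := by
      ext ω
      simp only [Set.mem_sdiff, Set.mem_inter_iff, Set.mem_compl_iff]
      constructor
      · rintro ⟨⟨hD', hab⟩, hav⟩
        exact ⟨⟨hD', hab⟩, fun hvb => hav (hab.trans (SimpleGraph.Reachable.symm hvb))⟩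
      · rintro ⟨⟨hD', hab⟩, hvb⟩
        exact ⟨⟨hD', hab⟩, fun hav => hvb ((SimpleGraph.Reachable.symm hav).trans hab)⟩
    rw [hdiff] at h
    linarith
  -- split `S wins` into `s wins without hijack` and the fresh wins of `v`
  have hwin : (prodBernoulli w).real ((openConn s b ∪ openConn v b) ∩ (openConn a s)ᶜ ∩ (openConn a v)ᶜ) =
      (prodBernoulli w).real (D ∩ openConn s b) - (prodBernoulli w).real (D ∩ openConn s b ∩ openConn a v)
        + (prodBernoulli w).real ((openConn v b : Set (BondConfig (Fin n))) ∩ (openConn s b)ᶜ ∩ D ∩ (openConn a v)ᶜ) := by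
    have h1 := measureReal_inter_add_sdiff (μ := prodBernoulli w) (s := D ∩ openConn s b)
      (MeasurableSet.of_discrete (s := (openConn a v : Set (BondConfig (Fin n)))))
    have hdisj : Disjoint ((D ∩ openConn s b) \ (openConn a v : Set (BondConfig (Fin n))))
        ((openConn v b : Set (BondConfig (Fin n))) ∩ (openConn s b)ᶜ ∩ D ∩ (openConn a v)ᶜ) := by
      rw [Set.disjoint_left]
      rintro ω ⟨⟨-, hsb⟩, -⟩ ⟨⟨⟨-, hsb'⟩, -⟩, -⟩
      exact hsb' hsb
    have hunion : ((D ∩ openConn s b) \ (openConn a v : Set (BondConfig (Fin n)))) ∪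
        ((openConn v b : Set (BondConfig (Fin n))) ∩ (openConn s b)ᶜ ∩ D ∩ (openConn a v)ᶜ) =
        (openConn s b ∪ openConn v b) ∩ (openConn a s)ᶜ ∩ (openConn a v)ᶜ := by
      ext ω
      simp only [Set.mem_union, Set.mem_sdiff, Set.mem_inter_iff, Set.mem_compl_iff, hD]
      constructor
      · rintro (⟨⟨hD', hsb⟩, hav⟩ | ⟨⟨⟨hvb, -⟩, hD'⟩, hav⟩)
        · exact ⟨⟨Or.inl hsb, hD'⟩, hav⟩
        · exact ⟨⟨Or.inr hvb, hD'⟩, hav⟩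
      · rintro ⟨⟨hsb | hvb, hD'⟩, hav⟩
        · exact Or.inl ⟨⟨hD', hsb⟩, hav⟩
        · by_cases hsb : ω ∈ openConn s b
          · exact Or.inl ⟨⟨hD', hsb⟩, hav⟩
          · exact Or.inr ⟨⟨⟨hvb, hsb⟩, hD'⟩, hav⟩
    have h2 := measureReal_union (μ := prodBernoulli w) hdisj (MeasurableSet.of_discrete)
    rw [hunion] at h2
    linarith
  have hfresh : 0 ≤ (prodBernoulli w).real ((openConn v b : Set (BondConfig (Fin n))) ∩ (openConn s b)ᶜ ∩ D ∩ (openConn a v)ᶜ) :=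
    measureReal_nonneg
  have hAb0 : 0 ≤ (prodBernoulli w).real (D ∩ openConn a b) := measureReal_nonneg
  rw [hE1, hsplit, hwin, hE2]
  nlinarith [hW, hfresh, hAb0]

/-- **Registered form** (`stub_pairStepOdds_v22786`, `--supports stmt-CriticalPhenomena-4576`): the one-relay odds inequality
`pairStep_odds` as a closed statement. [cite: VandenbergHaggstromKahn2005, Thm. 1.3 (p. 6), Thm. 1.4 (p. 7); KozmaNitzan2024, Lemma 1 (pp. 5–6)] -/
theorem stub_pairStepOdds_v22786 : ∀ (n : ℕ) (w : Sym2 (Fin n) → unitInterval) (a s v b : Fin n), a ≠ s → (Literature.Probability.LatticeModels.prodBernoulli w).real (Literature.Probability.Percolation.openConn s b ∩ (Literature.Probability.Percolation.openConn a s)ᶜ) * (Literature.Probability.LatticeModels.prodBernoulli w).real (Literature.Probability.Percolation.openConn a b ∩ (Literature.Probability.Percolation.openConn s b)ᶜ ∩ (Literature.Probability.Percolation.openConn v b)ᶜ) ≤ (Literature.Probability.LatticeModels.prodBernoulli w).real ((Literature.Probability.Percolation.openConn s b ∪ Literature.Probability.Percolation.openConn v b) ∩ (Literature.Probability.Percolation.openConn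 a s)ᶜ ∩ (Literature.Probability.Percolation.openConn a v)ᶜ) * (Literature.Probability.LatticeModels.prodBernoulli w).real (Literature.Probability.Percolation.openConn a b ∩ (Literature.Probability.Percolation.openConn s b)ᶜ) :=
  fun _ w a s v b has => pairStep_odds w a s v b has

end PairStepOdds

end

end Summit.CriticalPhenomena.PercolationContinuityZ3.Theorems
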